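import Summits.QuantumFields.YangMills.Theorems.BalabanUVNodesN17ShiftModulusCrossover
import Summits.QuantumFields.YangMills.Theorems.BalabanUVNodesN17ShiftModulusAnchor
import Literature.MathematicalPhysics.QuantumFieldTheory.Balaban1983to89.T4CouplingMatching

/-!
# NODE N17 (NE4) → THE N19′ CORE EDGE OF K3⁷, PART 2: NODE U2 UNDER A GENERAL SCALE-SHIFT MODULUS (last-only reading) — WHAT THE FULL β MUST HAND
# THE CROSSOVER: an injected modulus = the TAILS of the shift modulus; tails `p`-summable at an admissible exponent transport, the tails of `1∕(k+1)²` never do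

Cell `pub-ymgap`, YM-PLAN Track A (HUMAN RULING D-0062 ∕ D-0149), WIDTH SEAT `pub-ymgap-dag-n17-w2` (gen 3), key K3⁷ stmt-QuantumFields-20544
(`--kind proof --supports 20544 --as helper`, COUNT-NEUTRAL).  PART 1 (`…N17ShiftModulusCrossover`) settled the N19′-side threshold in `T4Crossover`'s currency: an
INJECTED two-run modulus `r` (a K-uniform bound `0 ≤ inj K j ≤ r_j`, `j ≤ K`, of the two runs' inverse-squared-coupling discrepancies) survives the crossover
`Σ_K Σ_{j+n=K} min(aⁿ, inj K j·Λⁿ) < ∞` as soon as `Σ_j r_j^p < ∞` at an ADMISSIBLE exponent (`a^{1−p}Λ^p < 1`), and a merely summable `r` does not.  THIS PART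
reads the threshold back to node N17's OWN letter — a scale-shift MODULUS `μ` of the full β, `|β_{k+2}(w) − β_{k+1}(Fin.tail w)| ≤ μ_k` on `]0,γ]^{k+2}` (the
gen-2 files' hypothesis shape; NE4 = `T4CouplingMatching.ScaleShiftRate c θ γ β` is `μ_k = c·θ^k`) — through node U2's PRINTED-READING Grönwall form
(`T4CouplingMatching.disc_le_of_lastOnly`: [Balaban1987RG1] (0.20) p. 256 «β_{k+1}(g_k)» + the p. 264 derivative clause made uniform, `LastOnlyLipschitz L γ β`;
the eventual asymptotic-freedom floor `EventualLowerH b γ k₀ β` behind (0.31)).  The tree's U2 theorems hard-wire the geometric source `c·θ^j`; here the source is `μ_j`.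

WHAT THIS FILE PROVES (theorems only; 0 `def`, 0 `instance`, 0 `notation`, 0 `sorry`).
§1 `disc_step_of_shiftModulus` — the backward coupling-matching recursion `δ_j ≤ δ_{j+1} + μ_j + Σ_{i≤j} Λ j i·(g^A_i)²g^B_{i+1}·δ_i` (`δ = disc gA gB`), the
modulus edition of `T4CouplingMatching.disc_step` (same proof, source `μ_j` for `c·θ^j`).
§2 `disc_le_sum_of_lastOnly_shiftModulus` — Markov feedback: `δ_j ≤ exp(2·Σ_{m∈[j,K)} L(g^A_m)²g^B_{m+1}) · Σ_{i∈[j,K)} μ_i` (`backward_gronwall` with source `μ`).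
§3 ★ `injectedModulus_of_runs_lastOnly_shiftModulus` — for the FAMILY of IR-pinned runs `g K` (as in `injectedRate_of_runs_lastOnly`): the K-UNIFORM INJECTED
MODULUS IS THE TAIL OF THE SHIFT MODULUS, `0 ≤ disc (g K) (g (K+1)) j ≤ E·Σ'_{i} μ_{i+j}` for `j ≤ K`, `E = exp(2L((k₀+1)γ³ + 2γ∕b))` (`Summable μ`).
§4 ★★ THE JUNCTION WITH PART 1 `summable_crossover_of_runs_lastOnly_shiftModulus` — node N17 with a shift modulus whose TAILS are `p`-summable at an admissible
exponent, `Σ_j (Σ'_i μ_{i+j})^p < ∞`, `a^{1−p}Λ^p < 1`, feeds a summable crossover `Σ_K Σ_{j+n=K} min(aⁿ, disc (g K) (g (K+1)) j·Λⁿ) < ∞` for the ACTUAL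
discrepancies (PART 1 `summable_crossover_of_injectedModulus_rpowSummable`); §5 the GEOMETRIC instance: under NE4 as typed (`ScaleShiftRate c θ γ β`, `0 < θ < 1`)
the tails are `≤ (c∕(1−θ))·θ^j` (`tail_le_of_geometric_shiftModulus`) and the crossover is summable for every `0 < a < 1`, `Λ ≥ 0`
(★ `summable_crossover_of_runs_lastOnly_scaleShiftRate`) — the K3⁷ N17 conjunct's reading, consistent with the edge of record.
§6 ★ THE N17-SIDE NEGATIVE `tails_inv_sq_not_rpowSummable`: the summable modulus `μ_k = 1∕(k+1)²` of gen 2's kernel witness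
(`N17ShiftModulusAnchor.summable_shiftModulus_anchor_not_geometric`) has tails `≥ 1∕(2(j+1))`, so `Σ_j (tail_j)^p = ∞` for EVERY `0 ≤ p ≤ 1` — at NO multiplicity
base `Λ > 1` and NO contraction `a` is §4's hypothesis met: under the last-only reading a summable-but-polynomial NE4 modulus hands the N19′ crossover NOTHING.

HONEST SCOPE (A6, director-ym №189).  Upper bounds and their failure only: §6 shows the HYPOTHESIS of §4 fails for `1∕(k+1)²`, not that the actual discrepancies
of some Bałaban run diverge; the fading-memory reading of node U2 (`disc_le_of_fadingMemory`, two-sided fixed point) is NOT generalised here — with a non-geometric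
source its closure needs a regularity of the modulus against the memory rate (`T4CouplingMatching` header: «with a uniform, non-fading modulus the two-sided recursion
is not closed by anything here»).  Elementary real analysis ([folklore]) over hypothesis SHAPES.  INHABITATION (v1.0.1): §5 discharges the MODULUS letters only; the
RUN ∕ β ∕ floor binders of §3–§5 are jointly inhabited BY NAME on the scale-dependent history-FLAT family `β k v = b + cθ^k` (explicit IR-pinned runs, exact discrepancy
`c(θ^j − θ^K)`; at `L = 0` §3's injected modulus `E·TAIL_j(μ) = cθ^j` is ATTAINED as `K → ∞` — the last-only bound is SHARP there) in the companion module
`…Theorems.BalabanUVNodesN17ShiftModulusCrossoverWitness` (`inhabits_injectedModulus_lastOnly`, `inhabits_crossover_lastOnly`); NOTHING is inhabited at Bałaban's β.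
Nothing of Bałaban asserted or instantiated; NE4 ∕ `LastOnlyLipschitz`-uniformity ∕ `EventualLowerH` ∕ NE7 NOT PRINTED as used and NOT proved;
no K2⁷∕K3⁷ stub proved; N17 ∕ N19 NOT discharged; K2⁷ ∕ K3⁷ OPEN; counts UNMOVED (typed 28∕28 · discharged 5∕28).  One finite four-torus programme at
fixed `ε = L^{−K}`, Bałaban AS PRINTED; the YM mass gap (Clay) is NOT proved by any of this — R4 closes the conditional finite-𝕋⁴ rung `BalabanLadder.UV` only;
nothing continuum ∕ ℝ⁴ ∕ OS.  References: [Balaban1987RG1] T. Bałaban, Commun. Math. Phys. **109** (1987), (0.20) p. 256, Thm 2 and (0.31) p. 259 (PDF 11; v1.0.1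
NIT-CITE repair of «(0.31) p. 258», ref-N g3 CLOSE-39 NIT-LOC ∕ g5 READ-41), §1 p. 264, §5 p. 298.  EDITION v1.0.1 (gen 5): docstring-only — the thirteen theorem
statements and proofs are byte-identical to v1 (p598022).
-/

noncomputable section

namespace Summit.QuantumFields.YangMills.BalabanUVNodes.N17ShiftModulusCrossoverU2

open Literature.MathematicalPhysics.QuantumFieldTheory.Balaban1983to89
open Literature.MathematicalPhysics.QuantumFieldTheory.Balaban1983to89.FlowStep
open Literature.MathematicalPhysics.QuantumFieldTheory.Balaban1983to89.T4CouplingMatching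
open Summit.QuantumFields.YangMills.BalabanUVNodes.N17ShiftModulusCrossover
  (summable_crossover_of_injectedModulus_rpowSummable rpowSummable_of_geometric_modulus exists_crossover_admissible_exponent)
open Summit.QuantumFields.YangMills.BalabanUVNodes.N17ShiftModulusAnchor (shiftModulus_nonneg)
open Finset

/-! ## §1 The backward recursion with a general source -/

/-- **THE BACKWARD COUPLING-MATCHING RECURSION under a scale-shift MODULUS** (modulus edition of `T4CouplingMatching.disc_step`, same proof): for `j < K`,
`δ_j ≤ δ_{j+1} + μ_j + Σ_{i≤j} Λ j i·(g^A_i)²g^B_{i+1}·δ_i`, `δ = disc gA gB` — subtract (0.20) of run A at step `j` from (0.20) of run B at step `j+1`; the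
β-difference splits into the SCALE SHIFT at B's couplings (`≤ μ_j`) and the HISTORY SHIFT at scale `j` (`HistLipschitz`).  Hypotheses, never facts.
[cite: Balaban1987RG1, (0.20) p.256] -/
theorem disc_step_of_shiftModulus {β : HBeta} {γ : ℝ} {μ : ℕ → ℝ} {Λ : ℕ → ℕ → ℝ} {K : ℕ} {gA gB : ℕ → ℝ}
    (hA : RGEqH K β gA) (hB : RGEqH (K + 1) β gB)
    (hAbox : ∀ i, i ≤ K → 0 < gA i ∧ gA i ≤ γ) (hBbox : ∀ i, i ≤ K + 1 → 0 < gB i ∧ gB i ≤ γ)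
    (hS : ∀ k (w : Fin (k + 2) → ℝ), w ∈ Box γ (k + 1) → |β (k + 1) w - β k (Fin.tail w)| ≤ μ k)
    (hL : HistLipschitz Λ γ β) (hΛ : ∀ k i, i ≤ k → 0 ≤ Λ k i)
    {j : ℕ} (hj : j < K) :
    disc gA gB j ≤ disc gA gB (j + 1) + μ j
      + ∑ i ∈ range (j + 1), Λ j i * ((gA i) ^ 2 * gB (i + 1)) * disc gA gB i := by
  have eA := hA j hj
  have eB := hB (j + 1) (by omega)
  have hwbox : prefixOf gB (j + 1) ∈ Box γ (j + 1) := prefixOf_mem_box (by omega) hBbox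
  have hpA : prefixOf gA j ∈ Box γ j := prefixOf_mem_box hj.le hAbox
  have htail : Fin.tail (prefixOf gB (j + 1)) ∈ Box γ j := by
    rw [tail_prefixOf]
    exact prefixOf_mem_box (N := K) hj.le fun i hi => hBbox (i + 1) (by omega)
  have h1 := hS j (prefixOf gB (j + 1)) hwbox
  have h2 := hL j (Fin.tail (prefixOf gB (j + 1))) (prefixOf gA j) htail hpA
  have h3 : ∑ i : Fin (j + 1), Λ j i * |Fin.tail (prefixOf gB (j + 1)) i - prefixOf gA j i|
      ≤ ∑ i ∈ range (j + 1), Λ j i * ((gA i) ^ 2 * gB (i + 1)) * disc gA gB i := by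
    rw [Finset.sum_range (fun i => Λ j i * ((gA i) ^ 2 * gB (i + 1)) * disc gA gB i)]
    refine Finset.sum_le_sum fun i _ => ?_
    have hiK : (i : ℕ) ≤ K := by have := i.isLt; omega
    have hgA := hAbox i hiK
    have hgB := hBbox (i + 1) (by omega)
    simp only [Fin.tail, prefixOf_apply, Fin.val_succ]
    rw [abs_sub_comm, mul_assoc]
    exact mul_le_mul_of_nonneg_left (abs_sub_le_of_inv_sq hgA.1 hgB.1)
      (hΛ j i (Nat.lt_succ_iff.mp i.isLt))
  have key : 1 / gA j ^ 2 - 1 / gB (j + 1) ^ 2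
      = (1 / gA (j + 1) ^ 2 - 1 / gB (j + 1 + 1) ^ 2)
        + (β j (prefixOf gA j) - β j (Fin.tail (prefixOf gB (j + 1))))
        - (β (j + 1) (prefixOf gB (j + 1)) - β j (Fin.tail (prefixOf gB (j + 1)))) := by
    rw [eA, eB]
    ring
  have habs : disc gA gB j ≤ disc gA gB (j + 1)
      + |β j (prefixOf gA j) - β j (Fin.tail (prefixOf gB (j + 1)))|
      + |β (j + 1) (prefixOf gB (j + 1)) - β j (Fin.tail (prefixOf gB (j + 1)))| := by
    simp only [disc]
    rw [key]
    exact (abs_sub _ _).trans (add_le_add (abs_add_le _ _) le_rfl)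
  have hcomm : |β j (prefixOf gA j) - β j (Fin.tail (prefixOf gB (j + 1)))|
      = |β j (Fin.tail (prefixOf gB (j + 1))) - β j (prefixOf gA j)| := abs_sub_comm _ _
  linarith [habs, hcomm, h1, h2, h3]

/-! ## §2 Markov-type feedback: the Grönwall form with a general source -/

/-- **NODE U2, LAST-ONLY GRÖNWALL FORM under a scale-shift MODULUS** (modulus edition of `T4CouplingMatching.disc_le_of_lastOnly`): two IR-pinned runs of (0.20),
couplings in `]0,γ]`, `LastOnlyLipschitz L γ β` with `Lγ³ ≤ ½`, and a modulus `μ ≥ 0` of the full β ⟹ for `j ≤ K`,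
`disc gA gB j ≤ exp(2·Σ_{m∈[j,K)} L(g^A_m)²g^B_{m+1}) · Σ_{i∈[j,K)} μ_i` (`§1` + `backward_gronwall`). [cite: Balaban1987RG1, (0.20) p.256 and §1 p.264] -/
theorem disc_le_sum_of_lastOnly_shiftModulus {β : HBeta} {γ L : ℝ} {μ : ℕ → ℝ} {K : ℕ} {gA gB : ℕ → ℝ}
    (hμ0 : ∀ k, 0 ≤ μ k) (hL0 : 0 ≤ L) (hLγ : L * γ ^ 3 ≤ 1 / 2)
    (hA : RGEqH K β gA) (hB : RGEqH (K + 1) β gB)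
    (hAbox : ∀ i, i ≤ K → 0 < gA i ∧ gA i ≤ γ) (hBbox : ∀ i, i ≤ K + 1 → 0 < gB i ∧ gB i ≤ γ)
    (hpin : gA K = gB (K + 1))
    (hS : ∀ k (w : Fin (k + 2) → ℝ), w ∈ Box γ (k + 1) → |β (k + 1) w - β k (Fin.tail w)| ≤ μ k)
    (hLip : LastOnlyLipschitz L γ β) :
    ∀ j, j ≤ K → disc gA gB j ≤ Real.exp (2 * ∑ m ∈ Ico j K, L * ((gA m) ^ 2 * gB (m + 1))) * ∑ i ∈ Ico j K, μ i := by
  -- the last-only modulus as history moduli concentrated on the diagonal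
  set Λ : ℕ → ℕ → ℝ := fun k i => if i = k then L else 0 with hΛdef
  have hHL : HistLipschitz Λ γ β := by
    have h := histLipschitz_of_lastOnly hLip
    simpa [hΛdef] using h
  have hΛ0 : ∀ k i, i ≤ k → 0 ≤ Λ k i := fun k i _ => by
    simp only [hΛdef]
    split_ifs <;> linarith
  -- truncated sequences for the abstract Grönwall lemma
  set δ : ℕ → ℝ := fun j => if j ≤ K then disc gA gB j else 0 with hδdef
  set ℓ : ℕ → ℝ := fun j => if j < K then L * ((gA j) ^ 2 * gB (j + 1)) else 0 with hℓdef
  have hδ0 : ∀ j, 0 ≤ δ j := fun j => by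
    simp only [hδdef]
    split_ifs
    · exact disc_nonneg _ _ _
    · exact le_rfl
  have hu : ∀ j, j < K → 0 ≤ (gA j) ^ 2 * gB (j + 1) ∧ (gA j) ^ 2 * gB (j + 1) ≤ γ ^ 3 := by
    intro j hj
    have hgA := hAbox j hj.le
    have hgB := hBbox (j + 1) (by omega)
    refine ⟨mul_nonneg (sq_nonneg _) hgB.1.le, ?_⟩
    have h1 : (gA j) ^ 2 ≤ γ ^ 2 := pow_le_pow_left₀ hgA.1.le hgA.2 2
    calc (gA j) ^ 2 * gB (j + 1) ≤ γ ^ 2 * γ := mul_le_mul h1 hgB.2 hgB.1.le (sq_nonneg _)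
      _ = γ ^ 3 := by ring
  have hℓ0 : ∀ j, 0 ≤ ℓ j := fun j => by
    simp only [hℓdef]
    split_ifs with hj
    · exact mul_nonneg hL0 (hu j hj).1
    · exact le_rfl
  have hℓ1 : ∀ j, ℓ j ≤ 1 / 2 := fun j => by
    simp only [hℓdef]
    split_ifs with hj
    · calc L * ((gA j) ^ 2 * gB (j + 1)) ≤ L * γ ^ 3 := mul_le_mul_of_nonneg_left (hu j hj).2 hL0
        _ ≤ 1 / 2 := hLγ
    · linarith
  have hK : δ K = 0 := by simp [hδdef, disc_pin hpin]
  have hrec : ∀ j, j < K → δ j ≤ δ (j + 1) + μ j + ℓ j * δ j := by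
    intro j hj
    have hstep := disc_step_of_shiftModulus hA hB hAbox hBbox hS hHL hΛ0 hj
    have e : ∑ i ∈ range (j + 1), Λ j i * ((gA i) ^ 2 * gB (i + 1)) * disc gA gB i
        = L * ((gA j) ^ 2 * gB (j + 1)) * disc gA gB j := by
      rw [Finset.sum_eq_single j]
      · simp [hΛdef]
      · intro i _ hi
        simp [hΛdef, hi]
      · simp
    rw [e] at hstep
    have hδj : δ j = disc gA gB j := by simp [hδdef, hj.le]
    have hδj1 : δ (j + 1) = disc gA gB (j + 1) := by simp [hδdef, Nat.succ_le_of_lt hj]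
    have hℓj : ℓ j = L * ((gA j) ^ 2 * gB (j + 1)) := by simp [hℓdef, hj]
    rw [hδj, hδj1, hℓj]
    exact hstep
  have hG := backward_gronwall hδ0 hμ0 hℓ0 hℓ1 hK hrec
  intro j hj
  have h := hG j hj
  have hδj : δ j = disc gA gB j := by simp [hδdef, hj]
  rw [hδj] at h
  have hprod : ∏ m ∈ Ico j K, (1 + 2 * ℓ m) ≤ Real.exp (2 * ∑ m ∈ Ico j K, L * ((gA m) ^ 2 * gB (m + 1))) := by
    have e : ∑ m ∈ Ico j K, L * ((gA m) ^ 2 * gB (m + 1)) = ∑ m ∈ Ico j K, ℓ m :=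
      Finset.sum_congr rfl fun m hm => by simp [hℓdef, (Finset.mem_Ico.mp hm).2]
    rw [e]
    exact prod_one_add_two_mul_le_exp hℓ0 j K
  have hsum0 : 0 ≤ ∑ i ∈ Ico j K, μ i := Finset.sum_nonneg fun i _ => hμ0 i
  exact h.trans (mul_le_mul_of_nonneg_right hprod hsum0)

/-! ## §3 The family of IR-pinned runs: the K-uniform injected modulus is the TAIL of the shift modulus -/

/-- a finite window of a non-negative summable sequence is below its tail sum: `Σ_{i∈[j,K)} μ_i ≤ Σ'_i μ_{i+j}`. [folklore] -/
theorem sum_Ico_le_tsum_tail {μ : ℕ → ℝ} (hμ0 : ∀ k, 0 ≤ μ k) (hsum : Summable μ) (j K : ℕ) :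
    ∑ i ∈ Ico j K, μ i ≤ ∑' i, μ (i + j) := by
  have hs' : Summable fun i => μ (i + j) := (summable_nat_add_iff j).mpr hsum
  rw [Finset.sum_Ico_eq_sum_range]
  calc ∑ i ∈ range (K - j), μ (j + i) = ∑ i ∈ range (K - j), μ (i + j) := by simp only [add_comm]
    _ ≤ ∑' i, μ (i + j) := hs'.sum_le_tsum (range (K - j)) fun i _ => hμ0 (i + j)

/-- the tails of a non-negative summable sequence are non-negative. [folklore] -/
theorem tsum_tail_nonneg {μ : ℕ → ℝ} (hμ0 : ∀ k, 0 ≤ μ k) (j : ℕ) : 0 ≤ ∑' i, μ (i + j) :=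
  tsum_nonneg fun i => hμ0 (i + j)

/-- ★ **NODE U2 FOR THE FAMILY OF RUNS under a scale-shift MODULUS — THE INJECTED MODULUS IS THE TAIL** (modulus edition of
`T4CouplingMatching.injectedRate_of_runs_lastOnly`): runs `g K` of (0.20) of every length, couplings in `]0,γ]`, IR-pinned at one `gIR`; last-only Lipschitz `L`
with `Lγ³ ≤ ½`; the EVENTUAL asymptotic-freedom floor `EventualLowerH b γ k₀ β` (the Grönwall exponent is then `≤ 2L((k₀+1)γ³ + 2γ∕b)`, K-uniform,
`sum_weights_le_of_eventualLower`); a SUMMABLE modulus `μ` of the full β on the window (`0 < γ`; `μ ≥ 0` by gen 2's `N17ShiftModulusAnchor.shiftModulus_nonneg`).  THEN for every cutoff `K` and `j ≤ K`: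
`0 ≤ disc (g K) (g (K+1)) j ≤ exp(2L((k₀+1)γ³ + 2γ∕b)) · Σ'_i μ_{i+j}` — the shape `0 ≤ inj K j ≤ r_j` of PART 1's `summable_crossover_of_injectedModulus_rpowSummable`
with `r_j = E·tail_j(μ)`.  Bookkeeping over UNPRINTED inputs. [cite: Balaban1987RG1, (0.20) p.256, Thm 2 p.259, §1 p.264] -/
theorem injectedModulus_of_runs_lastOnly_shiftModulus {β : HBeta} {γ b L : ℝ} {k₀ : ℕ} {μ : ℕ → ℝ} (g : ℕ → ℕ → ℝ) (gIR : ℝ)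
    (hγ : 0 < γ) (hb : 0 < b) (hL0 : 0 ≤ L) (hLγ : L * γ ^ 3 ≤ 1 / 2)
    (hrun : ∀ K, RGEqH K β (g K)) (hbox : ∀ K i, i ≤ K → 0 < g K i ∧ g K i ≤ γ) (hpin : ∀ K, g K K = gIR)
    (hS : ∀ k (w : Fin (k + 2) → ℝ), w ∈ Box γ (k + 1) → |β (k + 1) w - β k (Fin.tail w)| ≤ μ k)
    (hLip : LastOnlyLipschitz L γ β) (hlo : EventualLowerH b γ k₀ β) (hsum : Summable μ) :
    ∀ K j : ℕ, j ≤ K → 0 ≤ disc (g K) (g (K + 1)) j ∧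
      disc (g K) (g (K + 1)) j ≤ Real.exp (2 * (L * (((k₀ : ℝ) + 1) * γ ^ 3 + 2 * γ / b))) * ∑' i, μ (i + j) := by
  have hμ0 : ∀ k, 0 ≤ μ k := shiftModulus_nonneg hγ hS
  intro K j hj
  refine ⟨disc_nonneg _ _ _, ?_⟩
  have h := disc_le_sum_of_lastOnly_shiftModulus hμ0 hL0 hLγ (hrun K) (hrun (K + 1)) (hbox K) (hbox (K + 1))
    ((hpin K).trans (hpin (K + 1)).symm) hS hLip j hj
  have hU := sum_weights_le_of_eventualLower hγ hb (hrun K) (hrun (K + 1)) (hbox K) (hbox (K + 1)) hlo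
  -- the partial exponent sum over `Ico j K` is bounded by the full (reflected-profile) weight sum
  have hw0 : ∀ i, i ≤ K → 0 ≤ (g K i) ^ 2 * g (K + 1) (i + 1) := fun i hi =>
    mul_nonneg (sq_nonneg _) (hbox (K + 1) (i + 1) (by omega)).1.le
  have hpart : ∑ m ∈ Ico j K, L * ((g K m) ^ 2 * g (K + 1) (m + 1)) ≤ L * (((k₀ : ℝ) + 1) * γ ^ 3 + 2 * γ / b) := by
    rw [← Finset.mul_sum]
    refine mul_le_mul_of_nonneg_left (le_trans ?_ hU) hL0
    refine Finset.sum_le_sum_of_subset_of_nonneg (fun m hm => ?_) fun i hi _ => ?_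
    · exact mem_range.mpr (by have := (Finset.mem_Ico.mp hm).2; omega)
    · exact hw0 i (Nat.lt_succ_iff.mp (mem_range.mp hi))
  have hexp : Real.exp (2 * ∑ m ∈ Ico j K, L * ((g K m) ^ 2 * g (K + 1) (m + 1)))
      ≤ Real.exp (2 * (L * (((k₀ : ℝ) + 1) * γ ^ 3 + 2 * γ / b))) := Real.exp_le_exp.mpr (by linarith)
  have htail := sum_Ico_le_tsum_tail hμ0 hsum j K
  exact h.trans (mul_le_mul hexp htail (Finset.sum_nonneg fun i _ => hμ0 i) (Real.exp_pos _).le)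

/-! ## §4 The junction with PART 1: tails `p`-summable at an admissible exponent ⟹ the crossover with the actual discrepancies is summable -/

/-- ★★ **WHAT NODE N17 MUST HAND THE N19′ CROSSOVER (last-only reading of node U2).**  Under §3's hypotheses, if the TAILS of the shift modulus are `p`-summable,
`Σ_j (Σ'_i μ_{i+j})^p < ∞`, at an exponent `0 ≤ p ≤ 1` ADMISSIBLE for the contraction `a ≥ 0` and the multiplicity base `Λ ≥ 0` (`a^{1−p}·Λ^p < 1`), then the
crossover sums with the two runs' ACTUAL injected discrepancies, `K ↦ Σ_{j+n=K} min(aⁿ, disc (g K) (g (K+1)) j·Λⁿ)`, are summable over `K` (PART 1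
`summable_crossover_of_injectedModulus_rpowSummable` at `r_j = E·tail_j(μ)`).  The condition is on the TAILS and at an exponent `p < 1` once `Λ > 1` (PART 1
`threshold_lt_one`) — strictly stronger than `Σ μ < ∞` (§6). [folklore] -/
theorem summable_crossover_of_runs_lastOnly_shiftModulus {β : HBeta} {γ b L a Λ p : ℝ} {k₀ : ℕ} {μ : ℕ → ℝ} (g : ℕ → ℕ → ℝ) (gIR : ℝ)
    (hγ : 0 < γ) (hb : 0 < b) (hL0 : 0 ≤ L) (hLγ : L * γ ^ 3 ≤ 1 / 2)
    (hrun : ∀ K, RGEqH K β (g K)) (hbox : ∀ K i, i ≤ K → 0 < g K i ∧ g K i ≤ γ) (hpin : ∀ K, g K K = gIR)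
    (hS : ∀ k (w : Fin (k + 2) → ℝ), w ∈ Box γ (k + 1) → |β (k + 1) w - β k (Fin.tail w)| ≤ μ k)
    (hLip : LastOnlyLipschitz L γ β) (hlo : EventualLowerH b γ k₀ β) (hsum : Summable μ)
    (ha : 0 ≤ a) (hΛ : 0 ≤ Λ) (hp0 : 0 ≤ p) (hp1 : p ≤ 1) (hq : a ^ (1 - p) * Λ ^ p < 1)
    (htails : Summable fun j => (∑' i, μ (i + j)) ^ p) :
    Summable fun K => ∑ x ∈ antidiagonal K, min (a ^ x.2) (disc (g K) (g (K + 1)) x.1 * Λ ^ x.2) := by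
  set E : ℝ := Real.exp (2 * (L * (((k₀ : ℝ) + 1) * γ ^ 3 + 2 * γ / b))) with hE
  have hE0 : 0 ≤ E := (Real.exp_pos _).le
  have hμ0 : ∀ k, 0 ≤ μ k := shiftModulus_nonneg hγ hS
  have hinj := injectedModulus_of_runs_lastOnly_shiftModulus g gIR hγ hb hL0 hLγ hrun hbox hpin hS hLip hlo hsum
  have hs : Summable fun j => (E * ∑' i, μ (i + j)) ^ p := by
    refine (htails.mul_left (E ^ p)).congr fun j => ?_
    rw [Real.mul_rpow hE0 (tsum_tail_nonneg hμ0 j)]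
  exact summable_crossover_of_injectedModulus_rpowSummable (r := fun j => E * ∑' i, μ (i + j)) hinj ha hΛ hp0 hp1 hq hs

/-! ## §5 The geometric instance: NE4 as typed (`ScaleShiftRate`) — tails geometric, crossover summable for every `(a, Λ)` -/

/-- under a GEOMETRIC modulus `μ_k ≤ c·θ^k` (`0 ≤ θ < 1`, `μ ≥ 0` summable) the tails are geometric: `Σ'_i μ_{i+j} ≤ (c∕(1−θ))·θ^j`. [folklore] -/
theorem tail_le_of_geometric_shiftModulus {μ : ℕ → ℝ} {c θ : ℝ} (hθ0 : 0 ≤ θ) (hθ1 : θ < 1) (hμ0 : ∀ k, 0 ≤ μ k) (hμ : ∀ k, μ k ≤ c * θ ^ k)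
    (j : ℕ) : ∑' i, μ (i + j) ≤ c / (1 - θ) * θ ^ j := by
  have hc : 0 ≤ c := by simpa using (hμ0 0).trans (hμ 0)
  have hg : Summable fun i : ℕ => c * θ ^ j * θ ^ i := (summable_geometric_of_lt_one hθ0 hθ1).mul_left _
  have hdom : ∀ i, μ (i + j) ≤ c * θ ^ j * θ ^ i := fun i => by
    calc μ (i + j) ≤ c * θ ^ (i + j) := hμ (i + j)
      _ = c * θ ^ j * θ ^ i := by rw [pow_add]; ring
  have hsμ : Summable fun i => μ (i + j) := Summable.of_nonneg_of_le (fun i => hμ0 _) hdom hg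
  calc ∑' i, μ (i + j) ≤ ∑' i : ℕ, c * θ ^ j * θ ^ i := hsμ.tsum_le_tsum hdom hg
    _ = c * θ ^ j * ∑' i : ℕ, θ ^ i := tsum_mul_left
    _ = c * θ ^ j * (1 - θ)⁻¹ := by rw [tsum_geometric_of_lt_one hθ0 hθ1]
    _ = c / (1 - θ) * θ ^ j := by rw [div_eq_mul_inv]; ring

/-- a geometric modulus on a window is summable. [folklore] -/
theorem summable_of_geometric_shiftModulus {μ : ℕ → ℝ} {c θ : ℝ} (hθ0 : 0 ≤ θ) (hθ1 : θ < 1) (hμ0 : ∀ k, 0 ≤ μ k) (hμ : ∀ k, μ k ≤ c * θ ^ k) :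
    Summable μ :=
  Summable.of_nonneg_of_le hμ0 hμ ((summable_geometric_of_lt_one hθ0 hθ1).mul_left c)

/-- ★ **NE4 AS TYPED FEEDS A SUMMABLE CROSSOVER, EVERY `(a, Λ)`** (the K3⁷ N17 conjunct's reading through node U2's last-only form and PART 1): runs as in §3 with
`ScaleShiftRate c θ γ β`, `0 < θ < 1` ⟹ for every contraction `0 < a < 1` and every multiplicity base `Λ ≥ 0` the crossover sums with the actual injected
discrepancies are summable over `K` (tails geometric, `p`-summable for every `p > 0`; an admissible `p` exists).  Consistent with the edge of record
(`T4CouplingMatching.injectedRate_of_runs_lastOnly` + `T4Crossover.summable_sum_min_pow`), reached through the modulus road. [folklore] -/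
theorem summable_crossover_of_runs_lastOnly_scaleShiftRate {β : HBeta} {γ b L a Λ c θ : ℝ} {k₀ : ℕ} (g : ℕ → ℕ → ℝ) (gIR : ℝ)
    (hγ : 0 < γ) (hb : 0 < b) (hL0 : 0 ≤ L) (hLγ : L * γ ^ 3 ≤ 1 / 2) (hθ0 : 0 < θ) (hθ1 : θ < 1)
    (hrun : ∀ K, RGEqH K β (g K)) (hbox : ∀ K i, i ≤ K → 0 < g K i ∧ g K i ≤ γ) (hpin : ∀ K, g K K = gIR)
    (hS : ScaleShiftRate c θ γ β) (hLip : LastOnlyLipschitz L γ β) (hlo : EventualLowerH b γ k₀ β)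
    (ha0 : 0 < a) (ha1 : a < 1) (hΛ : 0 ≤ Λ) :
    Summable fun K => ∑ x ∈ antidiagonal K, min (a ^ x.2) (disc (g K) (g (K + 1)) x.1 * Λ ^ x.2) := by
  have hS' : ∀ k (w : Fin (k + 2) → ℝ), w ∈ Box γ (k + 1) → |β (k + 1) w - β k (Fin.tail w)| ≤ (fun k => c * θ ^ k) k := hS
  have hμ0 : ∀ k, 0 ≤ c * θ ^ k := shiftModulus_nonneg hγ hS'
  have hsum : Summable fun k => c * θ ^ k := summable_of_geometric_shiftModulus hθ0.le hθ1 hμ0 fun _ => le_rfl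
  obtain ⟨p, hp0, hp1, hq⟩ := exists_crossover_admissible_exponent ha0 ha1 hΛ
  have htail0 : ∀ j, 0 ≤ ∑' i, (fun k => c * θ ^ k) (i + j) := tsum_tail_nonneg hμ0
  have htails : Summable fun j => (∑' i, (fun k => c * θ ^ k) (i + j)) ^ p :=
    rpowSummable_of_geometric_modulus (C := c / (1 - θ)) hθ0.le hθ1 htail0
      (fun j => tail_le_of_geometric_shiftModulus hθ0.le hθ1 hμ0 (fun _ => le_rfl) j) hp0
  exact summable_crossover_of_runs_lastOnly_shiftModulus g gIR hγ hb hL0 hLγ hrun hbox hpin hS' hLip hlo hsum ha0.le hΛ hp0.le hp1 hq htails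

/-! ## §6 The N17-side negative: the tails of the summable modulus `1∕(k+1)²` are `p`-summable for NO `p ≤ 1` -/

/-- telescoping minorant: `1∕(n+1) − 1∕(n+2) ≤ 1∕(n+1)²` for real `n ≥ 0`. [folklore] -/
theorem sub_inv_le_inv_sq {x : ℝ} (hx : 0 ≤ x) : 1 / (x + 1) - 1 / (x + 2) ≤ 1 / (x + 1) ^ 2 := by
  rw [div_sub_div _ _ (by positivity) (by positivity), div_le_div_iff₀ (by positivity) (by positivity)]
  nlinarith

/-- the finite telescoping sum: `Σ_{i<N} (1∕(i+j+1) − 1∕(i+j+2)) = 1∕(j+1) − 1∕(N+j+1)`. [folklore] -/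
theorem sum_range_telescope (j N : ℕ) :
    ∑ i ∈ range N, (1 / ((i : ℝ) + j + 1) - 1 / ((i : ℝ) + j + 2)) = 1 / ((j : ℝ) + 1) - 1 / ((N : ℝ) + j + 1) := by
  induction N with
  | zero => simp
  | succ N ih =>
    rw [Finset.sum_range_succ, ih]
    push_cast
    ring

/-- THE TAILS OF `1∕(k+1)²` ARE AT LEAST HARMONIC: `1∕(2(j+1)) ≤ Σ'_i 1∕(i+j+1)²` (the first `j+1` terms telescope to `1∕(j+1) − 1∕(2j+2)`). [folklore] -/
theorem half_inv_le_tail_inv_sq (j : ℕ) : 1 / (2 * ((j : ℝ) + 1)) ≤ ∑' i : ℕ, 1 / ((((i + j : ℕ) : ℝ)) + 1) ^ 2 := by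
  have hsum : Summable fun k : ℕ => 1 / ((k : ℝ) + 1) ^ 2 := by
    have h := (summable_nat_add_iff 1).mpr (Real.summable_one_div_nat_pow.mpr one_lt_two)
    simp only [Nat.cast_add, Nat.cast_one] at h
    exact h
  have hs' : Summable fun i : ℕ => 1 / ((((i + j : ℕ) : ℝ)) + 1) ^ 2 := (summable_nat_add_iff j).mpr hsum
  have hfin : ∑ i ∈ range (j + 1), 1 / ((((i + j : ℕ) : ℝ)) + 1) ^ 2 ≤ ∑' i : ℕ, 1 / ((((i + j : ℕ) : ℝ)) + 1) ^ 2 :=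
    hs'.sum_le_tsum (range (j + 1)) fun i _ => by positivity
  refine le_trans ?_ hfin
  have hterm : ∀ i ∈ range (j + 1), 1 / ((i : ℝ) + j + 1) - 1 / ((i : ℝ) + j + 2) ≤ 1 / ((((i + j : ℕ) : ℝ)) + 1) ^ 2 := by
    intro i _
    have h := sub_inv_le_inv_sq (x := (i : ℝ) + j) (by positivity)
    push_cast
    convert h using 2
  have htel := sum_range_telescope j (j + 1)
  calc 1 / (2 * ((j : ℝ) + 1)) = 1 / ((j : ℝ) + 1) - 1 / (((j + 1 : ℕ) : ℝ) + j + 1) := by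
        push_cast
        field_simp
        ring
    _ = ∑ i ∈ range (j + 1), (1 / ((i : ℝ) + j + 1) - 1 / ((i : ℝ) + j + 2)) := htel.symm
    _ ≤ ∑ i ∈ range (j + 1), 1 / ((((i + j : ℕ) : ℝ)) + 1) ^ 2 := Finset.sum_le_sum hterm

/-- ★ **THE N17-SIDE NEGATIVE**: the tails of the SUMMABLE modulus `μ_k = 1∕(k+1)²` (gen 2's kernel witness `N17ShiftModulusAnchor.summable_shiftModulus_anchor_not_geometric`
has exactly this modulus) are `p`-summable for NO exponent `0 ≤ p ≤ 1` — so §4's hypothesis fails at EVERY admissible exponent, for every contraction `a` and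
every multiplicity base `Λ` (admissible exponents are `≤ 1`, and `< 1` once `Λ > 1`): under node U2's last-only reading a summable-but-polynomial NE4 modulus
hands the N19′ crossover nothing.  (`tail_j ≥ 1∕(2(j+1))`, and `x^p ≥ x` on `[0,1]` for `p ≤ 1`: harmonic minorant.) [folklore] -/
theorem tails_inv_sq_not_rpowSummable {p : ℝ} (hp0 : 0 ≤ p) (hp1 : p ≤ 1) :
    ¬ Summable (fun j : ℕ => (∑' i : ℕ, 1 / ((((i + j : ℕ) : ℝ)) + 1) ^ 2) ^ p) := by
  intro hs
  have hlow : ∀ j : ℕ, 1 / (2 * ((j : ℝ) + 1)) ≤ (∑' i : ℕ, 1 / ((((i + j : ℕ) : ℝ)) + 1) ^ 2) ^ p := by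
    intro j
    set t : ℝ := ∑' i : ℕ, 1 / ((((i + j : ℕ) : ℝ)) + 1) ^ 2 with ht
    have h1 : 1 / (2 * ((j : ℝ) + 1)) ≤ t := half_inv_le_tail_inv_sq j
    have hx0 : 0 < 1 / (2 * ((j : ℝ) + 1)) := by positivity
    have hx1 : 1 / (2 * ((j : ℝ) + 1)) ≤ 1 := by
      rw [div_le_one (by positivity)]
      have : (0 : ℝ) ≤ j := Nat.cast_nonneg j
      linarith
    -- `x ≤ x^p` for `x ∈ ]0,1]`, `p ≤ 1`, then monotonicity of `·^p` in the base
    calc 1 / (2 * ((j : ℝ) + 1)) = (1 / (2 * ((j : ℝ) + 1))) ^ (1 : ℝ) := (Real.rpow_one _).symm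
      _ ≤ (1 / (2 * ((j : ℝ) + 1))) ^ p := Real.rpow_le_rpow_of_exponent_ge hx0 hx1 hp1
      _ ≤ t ^ p := Real.rpow_le_rpow hx0.le h1 hp0
  have h1 : Summable fun j : ℕ => 1 / (2 * ((j : ℝ) + 1)) :=
    Summable.of_nonneg_of_le (fun j => by positivity) hlow hs
  have h2 : Summable fun j : ℕ => (fun m : ℕ => 1 / (m : ℝ)) (j + 1) := by
    refine (h1.mul_left 2).congr fun j => ?_
    push_cast
    field_simp
  exact Real.not_summable_one_div_natCast ((summable_nat_add_iff 1).mp h2)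

end Summit.QuantumFields.YangMills.BalabanUVNodes.N17ShiftModulusCrossoverU2

end
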